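import Summits.ResolutionOfSingularities.ResolutionOfSingularities.Theorems.WallFrames14
import Summits.ResolutionOfSingularities.ResolutionOfSingularities.Theorems.NearCutCompanion3
import Summits.ResolutionOfSingularities.ResolutionOfSingularities.Theorems.NearCutWalls2
import Summits.ResolutionOfSingularities.ResolutionOfSingularities.Theorems.ProximityCutArcLaw
import Summits.ResolutionOfSingularities.ResolutionOfSingularities.Theorems.MaxContactCutBoundaryLedger
import Summits.ResolutionOfSingularities.ResolutionOfSingularities.Theorems.MaxContactCutWallCut
import Summits.ResolutionOfSingularities.ResolutionOfSingularities.Theorems.PlanarGhostDescent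
import Literature.AlgebraicGeometry.Resolution.PointBlowupIFPGiraud
import Literature.AlgebraicGeometry.Resolution.AdicNoetherian
import HarnessLib

/-!
# WallFrames (15/17) — Kollár's wall descent in a polynomial frame; sections: Chain (cont.)

Verbatim slice of the farm-checked monolith `WallFrames.lean` of cell `decomp-res`, seat `decomp-res-lens-5`, g35
(sha256 7405a21d81d102a4…, monolith lines 3465–3701); one namespace `Summit.ResolutionOfSingularities.ResolutionOfSingularities.Theorems.WallFrames` across the
slices, imports chained.  The monolith's module docstring (laws W1–W7, mechanism, novelty, honest placement) is
reproduced in slice 1; the main theorem `balancedWallPort_holds : WallCut.BalancedWallPort` (hypothesis-free) and the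
host-route corollary `ecBalancedWallPort_holds` (aside item 27368 of route MaxContactCut) are in slice 16/17.
-/

open MvPolynomial Finset
open scoped BigOperators
open Literature.AlgebraicGeometry.Resolution
open Literature.AlgebraicGeometry.Resolution.Hauser2010
open Literature.AlgebraicGeometry.Resolution.PointBlowup
open Literature.AlgebraicGeometry.Resolution.HauserPerlega2024

namespace Summit.ResolutionOfSingularities.ResolutionOfSingularities.Theorems.WallFrames

variable {σ : Type*} [Fintype σ] [DecidableEq σ] {K : Type*} [Field K]

section Chain

variable {L : Type} [Field L] [DecidableEq L]

/-- **THE CHAIN THEOREM.** [new] -/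
theorem presentation_chain {q : ℕ} {s₀ : State (Fin 3) L} (W : TightDefectClasses.ForcedWalk q s₀) (N s : ℕ)
    (hs : s ≠ 0) (hGs : ∀ n, ordZero (NearCut.companion W N s n) = (s : ℕ∞))
    (f : ℕ → Fin 3)
    (hlin : ∀ n, constantCoeff (lineage W N s (f 0) n) = 0 ∧
      coeff (Finsupp.single (f n) 1) (lineage W N s (f 0) n) ≠ 0)
    (w : ℕ → Bool) (S1 S2 : ℕ → Fin 3)
    (hI : ∀ τ, S1 τ ≠ S2 τ ∧ S1 τ ≠ f τ ∧ S2 τ ≠ f τ ∧ (∀ i, i = f τ ∨ i = S1 τ ∨ i = S2 τ))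
    (hII : ∀ τ, ∃ kp ls : Fin 3,
        ((w τ = true ∧ ls = S1 τ ∧ kp = S2 τ ∧ S1 (τ + 1) = W.j (N + τ) ∧ S2 (τ + 1) = S2 τ) ∨
         (w τ = false ∧ ls = S2 τ ∧ kp = S1 τ ∧ S2 (τ + 1) = W.j (N + τ) ∧ S1 (τ + 1) = S1 τ)) ∧
        kp ≠ W.j (N + τ) ∧ W.b (N + τ) kp = 0 ∧
        ((W.j (N + τ) = ls ∧ f (τ + 1) = f τ ∧ ∀ i, i ≠ f τ → W.b (N + τ) i = 0) ∨
         (W.j (N + τ) = f τ ∧ f (τ + 1) = ls ∧ W.b (N + τ) ls ≠ 0 ∧ ∀ i, i ≠ ls → W.b (N + τ) i = 0)))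
    (Λ₀ : ℕ) {ζ₀ : MvPolynomial (Fin 3) L} (hζ₀ : (∀ μ ∈ ζ₀.support, μ (f 0) = 0))
    (hζ₀1 : (1 : ℕ∞) ≤ ordZero ζ₀)
    (hζ₀D : ((Λ₀ + 2 : ℕ) : ℕ∞) ≤ ordZero (vsubst (f 0) ζ₀ (lineage W N s (f 0) 0)))
    (A : Finset (Fin 3 →₀ ℕ)) {U₀ : (Fin 3 →₀ ℕ) → MvPolynomial (Fin 3) L} {R₀ : MvPolynomial (Fin 3) L}
    (hU₀ : ∀ a ∈ A, constantCoeff (U₀ a) ≠ 0) (hR₀ : ∀ d ∈ R₀.support, Λ₀ + d (f 0) ≤ d.degree)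
    (hpres₀ : zshear (f 0) ζ₀ (NearCut.companion W N s 0) = ∑ a ∈ A, monomial a 1 * U₀ a + R₀)
    (x₀ : (Fin 3 →₀ ℕ) → ℤ × ℤ)
    (hx₀ : ∀ a, x₀ a = (((a (S1 0) : ℕ) : ℤ) - ((s : ℤ) - a (f 0)), ((a (S2 0) : ℕ) : ℤ) - ((s : ℤ) - a (f 0)))) :
    ∀ τ, s * τ ≤ Λ₀ → ∃ (ζ : MvPolynomial (Fin 3) L) (ι : (Fin 3 →₀ ℕ) → (Fin 3 →₀ ℕ))
      (Uα : (Fin 3 →₀ ℕ) → MvPolynomial (Fin 3) L) (R : MvPolynomial (Fin 3) L),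
      (∀ μ ∈ ζ.support, μ (f τ) = 0) ∧ (1 : ℕ∞) ≤ ordZero ζ ∧
      ((Λ₀ - s * τ + 2 : ℕ) : ℕ∞) ≤ ordZero (vsubst (f τ) ζ (lineage W N s (f 0) τ)) ∧
      (∀ a ∈ A, ∀ a' ∈ A, ι a = ι a' → a = a') ∧ (∀ a ∈ A, constantCoeff (Uα a) ≠ 0) ∧
      (∀ d ∈ R.support, (Λ₀ - s * τ) + d (f τ) ≤ d.degree) ∧
      zshear (f τ) ζ (NearCut.companion W N s τ) = ∑ a ∈ A, monomial (ι a) 1 * Uα a + R ∧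
      (∀ a ∈ A, (ι a) (f τ) = a (f 0) ∧
        (((ι a) (S1 τ) : ℕ) : ℤ) - ((s : ℤ) - a (f 0)) = (ExtinctionCut.orbit w (x₀ a) τ).1 ∧
        (((ι a) (S2 τ) : ℕ) : ℤ) - ((s : ℤ) - a (f 0)) = (ExtinctionCut.orbit w (x₀ a) τ).2) := by
  classical
  have hs1 : 1 ≤ s := Nat.pos_of_ne_zero hs
  have hGle : ∀ n, (s : ℕ∞) ≤ ordZero (NearCut.companion W N s n) := fun n => (hGs n).ge
  -- the centre lies on the lineage
  have hcentre : ∀ n, eval (W.b (N + n)) (chartTransform 1 (W.j (N + n)) (lineage W N s (f 0) n)) = 0 :=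
    centre_on_lineage hs1 (fun n => NearCut.companion W N s n) (lineage W N s (f 0)) (fun n => W.j (N + n))
      (fun n => W.b (N + n)) hGle (fun n => NearCut.companion_succ W N s n)
      (hasseDeriv_mem_hasseSpan (by rw [Finsupp.degree_single]) _) (fun n => rfl)
  intro τ
  induction τ with
  | zero =>
    intro _
    refine ⟨ζ₀, fun n => n, U₀, R₀, hζ₀, hζ₀1, by simpa using hζ₀D, fun a _ a' _ h => h, hU₀, by simpa using hR₀,
      hpres₀, fun a ha => ⟨rfl, ?_, ?_⟩⟩
    · rw [ExtinctionCut.orbit_zero, hx₀]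
    · rw [ExtinctionCut.orbit_zero, hx₀]
  | succ τ ih =>
    intro hτ
    have hτ' : s * τ ≤ Λ₀ := le_trans (Nat.mul_le_mul_left s (Nat.le_succ τ)) hτ
    obtain ⟨ζ, ι, Uα, R, hζ, hζ1, hD, hι, hU, hR, hpres, htor⟩ := ih hτ'
    -- abbreviations
    set Λ := Λ₀ - s * τ with hΛdef
    have hsΛ : s ≤ Λ := by rw [hΛdef, Nat.mul_succ] at *; omega
    have hΛ' : Λ - s = Λ₀ - s * (τ + 1) := by rw [hΛdef, Nat.mul_succ]; omega
    set h := lineage W N s (f 0) τ with hhdef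
    obtain ⟨Q, hfac⟩ := exists_factor (f τ) ζ h
    have hQ0 : constantCoeff Q ≠ 0 := by
      rw [constantCoeff_factor hζ hζ1 hfac]; exact (hlin τ).2
    have hD' : ((Λ + 1 + 1 : ℕ) : ℕ∞) ≤ ordZero (vsubst (f τ) ζ h) := by
      have : Λ + 1 + 1 = Λ₀ - s * τ + 2 := by rw [hΛdef]
      rw [this]; exact hD
    obtain ⟨hS12, hS1f, hS2f, hexh⟩ := hI τ
    have hK2 : ∀ a ∈ A, s ≤ (ι a).degree :=
      degree_ge_of_mem_presentation A ι Uα R hι hU (fun d hd => by have := hR d hd; omega)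
        (by rw [← hpres, ordZero_zshear hζ hζ1]; exact hGle τ)
    have hdeg : ∀ a ∈ A, (ι a).degree = (ι a) (f τ) + (ι a) (S1 τ) + (ι a) (S2 τ) := fun a ha =>
      degree_eq_of_three hS1f.symm hS2f.symm hS12 hexh (ι a)
    obtain ⟨kp, ls, hslot, hkpj, hbkp, hmove⟩ := hII τ
    have hlsf : ls ≠ f τ := by
      rcases hslot with ⟨-, h1, -⟩ | ⟨-, h1, -⟩
      · rw [h1]; exact hS1f
      · rw [h1]; exact hS2f
    rcases hmove with ⟨hjls, hff, hb⟩ | ⟨hjf, hfls, hbls, hb⟩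
    · ------------------------------------------------------------------ LOST-WALL MOVE
      have hjz : W.j (N + τ) ≠ f τ := by rw [hjls]; exact hlsf
      obtain ⟨hζ'free, hζ'1, -, -, -, hdepth⟩ :=
        jet_transport hjz hb hζ hζ1 hfac hQ0 (by omega : 1 ≤ Λ + 1) hD' (hcentre τ)
      obtain ⟨hS, hι', hU', hR', hpres'⟩ :=
        presentation_transport_step hjz hζ hζ1 hb hsΛ (hGle τ) hι hU hR hpres
      refine ⟨chartTransform 1 (W.j (N + τ)) ζ - C (W.b (N + τ) (f τ)), fun a => chartExponent s (W.j (N + τ)) (ι a),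
        fun a => chartTransform 0 (W.j (N + τ)) (Uα a), chartTransform s (W.j (N + τ)) R, ?_, ?_, ?_, hι', hU', ?_, ?_, ?_⟩
      · rw [hff]; exact hζ'free
      · exact hζ'1
      · rw [hff, lineage_succ]
        refine le_trans ?_ hdepth
        exact_mod_cast (by rw [Nat.mul_succ]; omega : Λ₀ - s * (τ + 1) + 2 ≤ Λ + 1)
      · rw [hff, ← hΛ']; exact hR'
      · rw [hff, NearCut.companion_succ]; exact hpres'
      · intro a ha
        obtain ⟨haf, h1, h2⟩ := htor a ha
        have hK := hK2 a ha
        have hdg := hdeg a ha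
        refine ⟨by rw [hff, chartExponent_apply, if_neg hjz.symm, haf], ?_, ?_⟩
        · rcases hslot with ⟨hw, hls, hkp, hS1', hS2'⟩ | ⟨hw, hls, hkp, hS2', hS1'⟩
          · rw [(ExtinctionCut.orbit_succ_of_true (x := x₀ a) hw).1, ← h1, ← h2, hS1', chartExponent_apply, if_pos rfl,
              Nat.cast_sub hK, hdg]
            push_cast
            omega
          · have hne : S1 τ ≠ W.j (N + τ) := by rw [hjls, hls]; exact hS12
            rw [(ExtinctionCut.orbit_succ_of_false (x := x₀ a) hw).1, ← h1, hS1', chartExponent_apply, if_neg hne]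
        · rcases hslot with ⟨hw, hls, hkp, hS1', hS2'⟩ | ⟨hw, hls, hkp, hS2', hS1'⟩
          · have hne : S2 τ ≠ W.j (N + τ) := by rw [hjls, hls]; exact hS12.symm
            rw [(ExtinctionCut.orbit_succ_of_true (x := x₀ a) hw).2, ← h2, hS2', chartExponent_apply, if_neg hne]
          · rw [(ExtinctionCut.orbit_succ_of_false (x := x₀ a) hw).2, ← h1, ← h2, hS2', chartExponent_apply, if_pos rfl,
              Nat.cast_sub hK, hdg]
            push_cast
            omega
    · ------------------------------------------------------------------ FREE-CHART MOVE
      have hkpls : kp ≠ ls := by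
        rcases hslot with ⟨-, h1, h2, -⟩ | ⟨-, h1, h2, -⟩
        · rw [h1, h2]; exact hS12.symm
        · rw [h1, h2]; exact hS12
      have hkpf : kp ≠ f τ := by rw [← hjf]; exact hkpj
      have hσ3 : ∀ i, i = kp ∨ i = ls ∨ i = f τ := fun i => by
        rcases hexh i with h0 | h0 | h0
        · exact Or.inr (Or.inr h0)
        · rcases hslot with ⟨-, h1, h2, -⟩ | ⟨-, h1, h2, -⟩
          · exact Or.inr (Or.inl (h0.trans h1.symm))
          · exact Or.inl (h0.trans h2.symm)
        · rcases hslot with ⟨-, h1, h2, -⟩ | ⟨-, h1, h2, -⟩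
          · exact Or.inl (h0.trans h2.symm)
          · exact Or.inr (Or.inl (h0.trans h1.symm))
      -- the rotated lineage
      have hlin1 : constantCoeff (PointBlowup.translate (W.b (N + τ)) (chartTransform 1 (f τ) h)) = 0 := by
        have := (hlin (τ + 1)).1
        rwa [lineage_succ, hjf] at this
      obtain ⟨-, -, hg0, hcoef, -, hjets⟩ := jet_rotation hlsf hb hζ1 hfac hQ0 (by omega : 1 ≤ Λ + 1) hD' hlin1
      set g := PointBlowup.translate (W.b (N + τ)) (1 - chartTransform 1 (f τ) ζ) with hgdef
      have hcg : coeff (Finsupp.single ls 1) g ≠ 0 := by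
        intro h0
        have := (hlin (τ + 1)).2
        rw [lineage_succ, hjf, hfls, hcoef, h0, mul_zero] at this
        exact this rfl
      obtain ⟨ζ₂, hζ₂, hζ₂1, hζ₂D⟩ := exists_jet ls hg0 hcg Λ
      obtain ⟨Qg, hgfac⟩ := exists_factor ls ζ₂ g
      have hQg : constantCoeff Qg ≠ 0 := by rw [constantCoeff_factor hζ₂ hζ₂1 hgfac]; exact hcg
      have hrg : (∀ μ ∈ (vsubst ls ζ₂ g).support, μ ls = 0) := varFree_vsubst hζ₂ g
      have hrgΛ : ((Λ - s : ℕ) : ℕ∞) ≤ ordZero (vsubst ls ζ₂ g) :=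
        le_trans (by exact_mod_cast (by omega : Λ - s ≤ Λ + 1)) hζ₂D
      obtain ⟨U', R', hS3, hι', hU', hR', hpres'⟩ :=
        presentation_freeChart_step hkpls hkpf hlsf hσ3 (rfl : W.b (N + τ) ls = W.b (N + τ) ls) hb hbls hζ hζ1
          hζ₂ hζ₂1 hrg hQg hgfac hsΛ hrgΛ (hGle τ) hι hU hR hpres
      have hdepth := hjets ζ₂ hζ₂1 Λ hζ₂D
      refine ⟨ζ₂, fun a => Finsupp.single kp ((ι a) kp) + Finsupp.single (f τ) ((ι a) kp + (ι a) ls + (ι a) (f τ) - s) +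
          Finsupp.single ls ((ι a) (f τ)), U', R', ?_, ?_, ?_, hι', hU', ?_, ?_, ?_⟩
      · rw [hfls]; exact hζ₂
      · exact hζ₂1
      · rw [hfls, lineage_succ, hjf]
        refine le_trans ?_ hdepth
        exact_mod_cast (by rw [Nat.mul_succ]; omega : Λ₀ - s * (τ + 1) + 2 ≤ min (Λ + 1) (Λ + 1))
      · rw [hfls, ← hΛ']; exact hR'
      · rw [hfls, NearCut.companion_succ, hjf]; exact hpres'
      · intro a ha
        obtain ⟨haf, h1, h2⟩ := htor a ha
        have hK := hS3 a ha
        have hv : ∀ c₁ c₂ c₃ : ℕ, (Finsupp.single kp c₁ + Finsupp.single (f τ) c₂ + Finsupp.single ls c₃) ls = c₃ := by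
          intro c₁ c₂ c₃
          simp only [Finsupp.add_apply, Finsupp.single_apply, if_neg hkpls, if_neg hlsf.symm, if_true, zero_add]
        have hu : ∀ c₁ c₂ c₃ : ℕ, (Finsupp.single kp c₁ + Finsupp.single (f τ) c₂ + Finsupp.single ls c₃) kp = c₁ := by
          intro c₁ c₂ c₃
          simp only [Finsupp.add_apply, Finsupp.single_apply, if_neg hkpf.symm, if_neg hkpls.symm,
            if_true, add_zero]
        have hz : ∀ c₁ c₂ c₃ : ℕ, (Finsupp.single kp c₁ + Finsupp.single (f τ) c₂ + Finsupp.single ls c₃) (f τ) = c₂ := by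
          intro c₁ c₂ c₃
          simp only [Finsupp.add_apply, Finsupp.single_apply, if_neg hkpf, if_neg hlsf, if_true,
            zero_add, add_zero]
        refine ⟨by rw [hfls, hv, haf], ?_, ?_⟩
        · rcases hslot with ⟨hw, hls, hkp, hS1', hS2'⟩ | ⟨hw, hls, hkp, hS2', hS1'⟩
          · rw [(ExtinctionCut.orbit_succ_of_true (x := x₀ a) hw).1, ← h1, ← h2, hS1', hjf, hz, ← hls, ← hkp,
              Nat.cast_sub hK, haf]
            push_cast
            omega
          · rw [(ExtinctionCut.orbit_succ_of_false (x := x₀ a) hw).1, ← h1, hS1', ← hkp, hu]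
        · rcases hslot with ⟨hw, hls, hkp, hS1', hS2'⟩ | ⟨hw, hls, hkp, hS2', hS1'⟩
          · rw [(ExtinctionCut.orbit_succ_of_true (x := x₀ a) hw).2, ← h2, hS2', ← hkp, hu]
          · rw [(ExtinctionCut.orbit_succ_of_false (x := x₀ a) hw).2, ← h1, ← h2, hS2', hjf, hz, ← hls, ← hkp,
              Nat.cast_sub hK, haf]
            push_cast
            omega

/-- **THE CHAIN AT A GIVEN BUDGET**: initial jet and initial presentation supplied (`exists_jet`,
`presentation_of_support`). [new] -/
theorem presentation_chain_at {q : ℕ} {s₀ : State (Fin 3) L} (W : TightDefectClasses.ForcedWalk q s₀) (N s : ℕ)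
    (hs : s ≠ 0) (hGs : ∀ n, ordZero (NearCut.companion W N s n) = (s : ℕ∞))
    (f : ℕ → Fin 3)
    (hlin : ∀ n, constantCoeff (lineage W N s (f 0) n) = 0 ∧
      coeff (Finsupp.single (f n) 1) (lineage W N s (f 0) n) ≠ 0)
    (w : ℕ → Bool) (S1 S2 : ℕ → Fin 3)
    (hI : ∀ τ, S1 τ ≠ S2 τ ∧ S1 τ ≠ f τ ∧ S2 τ ≠ f τ ∧ (∀ i, i = f τ ∨ i = S1 τ ∨ i = S2 τ))
    (hII : ∀ τ, ∃ kp ls : Fin 3,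
        ((w τ = true ∧ ls = S1 τ ∧ kp = S2 τ ∧ S1 (τ + 1) = W.j (N + τ) ∧ S2 (τ + 1) = S2 τ) ∨
         (w τ = false ∧ ls = S2 τ ∧ kp = S1 τ ∧ S2 (τ + 1) = W.j (N + τ) ∧ S1 (τ + 1) = S1 τ)) ∧
        kp ≠ W.j (N + τ) ∧ W.b (N + τ) kp = 0 ∧
        ((W.j (N + τ) = ls ∧ f (τ + 1) = f τ ∧ ∀ i, i ≠ f τ → W.b (N + τ) i = 0) ∨
         (W.j (N + τ) = f τ ∧ f (τ + 1) = ls ∧ W.b (N + τ) ls ≠ 0 ∧ ∀ i, i ≠ ls → W.b (N + τ) i = 0)))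
    (Λ₀ : ℕ) (x₀ : (Fin 3 →₀ ℕ) → ℤ × ℤ)
    (hx₀ : ∀ a, x₀ a = (((a (S1 0) : ℕ) : ℤ) - ((s : ℤ) - a (f 0)), ((a (S2 0) : ℕ) : ℤ) - ((s : ℤ) - a (f 0)))) :
    ∃ ζ₀ : MvPolynomial (Fin 3) L, (∀ μ ∈ ζ₀.support, μ (f 0) = 0) ∧ (1 : ℕ∞) ≤ ordZero ζ₀ ∧
      ((Λ₀ + 2 : ℕ) : ℕ∞) ≤ ordZero (vsubst (f 0) ζ₀ (lineage W N s (f 0) 0)) ∧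
    ∀ τ, s * τ ≤ Λ₀ → ∃ (ζ : MvPolynomial (Fin 3) L) (ι : (Fin 3 →₀ ℕ) → (Fin 3 →₀ ℕ))
      (Uα : (Fin 3 →₀ ℕ) → MvPolynomial (Fin 3) L) (R : MvPolynomial (Fin 3) L),
      (∀ μ ∈ ζ.support, μ (f τ) = 0) ∧ (1 : ℕ∞) ≤ ordZero ζ ∧
      ((Λ₀ - s * τ + 2 : ℕ) : ℕ∞) ≤ ordZero (vsubst (f τ) ζ (lineage W N s (f 0) τ)) ∧
      (∀ a ∈ (zshear (f 0) ζ₀ (NearCut.companion W N s 0)).support.filter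
          (fun n => n.degree < Λ₀ + n (f 0)),
        ∀ a' ∈ (zshear (f 0) ζ₀ (NearCut.companion W N s 0)).support.filter
          (fun n => n.degree < Λ₀ + n (f 0)), ι a = ι a' → a = a') ∧
      (∀ a ∈ (zshear (f 0) ζ₀ (NearCut.companion W N s 0)).support.filter
          (fun n => n.degree < Λ₀ + n (f 0)), constantCoeff (Uα a) ≠ 0) ∧
      (∀ d ∈ R.support, (Λ₀ - s * τ) + d (f τ) ≤ d.degree) ∧
      zshear (f τ) ζ (NearCut.companion W N s τ) =
        ∑ a ∈ (zshear (f 0) ζ₀ (NearCut.companion W N s 0)).support.filter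
          (fun n => n.degree < Λ₀ + n (f 0)), monomial (ι a) 1 * Uα a + R ∧
      (∀ a ∈ (zshear (f 0) ζ₀ (NearCut.companion W N s 0)).support.filter
          (fun n => n.degree < Λ₀ + n (f 0)), (ι a) (f τ) = a (f 0) ∧
        (((ι a) (S1 τ) : ℕ) : ℤ) - ((s : ℤ) - a (f 0)) = (ExtinctionCut.orbit w (x₀ a) τ).1 ∧
        (((ι a) (S2 τ) : ℕ) : ℤ) - ((s : ℤ) - a (f 0)) = (ExtinctionCut.orbit w (x₀ a) τ).2) := by
  classical
  obtain ⟨ζ₀, hζ₀, hζ₀1, hζ₀D⟩ := exists_jet (f 0) (hlin 0).1 (hlin 0).2 (Λ₀ + 1)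
  obtain ⟨hP, hU₀, hR₀⟩ := presentation_of_support (f 0) Λ₀ (zshear (f 0) ζ₀ (NearCut.companion W N s 0))
  exact ⟨ζ₀, hζ₀, hζ₀1, hζ₀D,
    presentation_chain W N s hs hGs f hlin w S1 S2 hI hII Λ₀ hζ₀ hζ₀1 hζ₀D _ hU₀ hR₀ hP x₀ hx₀⟩

end Chain

/-! ## §23 THE PORT: `WallCut.BalancedWallPort` HOLDS (programme «WallDescent», the +1)

The conclusion of `BalancedWallPort` is reached through `False`: a δ-balanced tame tail with recurring repeats
cannot exist.  Chain of landed / above facts: `NearCut.tailInv_of_balanced` (structure `F = y^r U G + C`,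
`ord G = s`), the layer law (`NearCut.layer_of_structure`) and `NearCut.directrix_of_plateau` (tangent cone of
`G_n` a pure `s`-th power `c ℓ_n^s`), `transversal` (§16: `ℓ_n ∌` … is transversal to the free axis), `lineage_facts`
(§17), `toric_slots` (§20), `ExtinctionCut.both_letters_of_switches` + `ExtinctionCut.extinction` (landed toric
kernel; its for-all-times potential hypothesis is served by `presentation_chain_at` at every budget together with
`coeff_zshear_stable` + `jet_unique`), the chain at the isolation horizon, and `no_isolation_of_presentation` (§19)
against `ForcedWalk.isolated`. -/

end Summit.ResolutionOfSingularities.ResolutionOfSingularities.Theorems.WallFrames
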